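import Summits.AtomisticToContinuum.Crystallization.Theorems.FrustratedLawDichotomyStrainedPatchHomLeafTableSums
import Summits.AtomisticToContinuum.Crystallization.Theorems.FrustratedLawDichotomyStrainedPatchHomLeafPoints

/-!
# v2 leaf checker — soundness, part A: data readings, `Fin 9 ↔ 3×3` sums, the accumulator sums (critic row 806 (2)(C))

decomp-a2c hand-1 g20 (crux `AperiodicFrustratedLawGap`, stmt-AtomisticToContinuum-27623).  Proof-side readings `NL.toLab`, `GB.cz/wz`, `rowT`, `dlt`;
the real Gram-coordinate identities `ell0_eq` / `rad_real_eq` (centre value `(qPos − qNeg)/SC`, radius `rad/SC`); ★ `acc_sums`: for a passing fold the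
signed accumulator fields are the sums over the treated visited records of the per-record data read from the rows used.  0 sorry; standard axioms.
`--supports stmt-AtomisticToContinuum-27623`.
-/

noncomputable section

namespace Summit.AtomisticToContinuum.Crystallization.Theorems.FrustratedLawDichotomyStrainedPatchHomLeafTableCheck

open scoped BigOperators RealInnerProductSpace
open Set
open Literature.Analysis.ValidatedNumerics.Numerics
open Summit.AtomisticToContinuum.Crystallization.Theorems.ChargedEnergyGapNegative (E3)
open Summit.AtomisticToContinuum.Crystallization.Theorems.FrustratedLawDichotomySchurCut (effPot w₄₅ ω₄)
open Summit.AtomisticToContinuum.Crystallization.Theorems.FrustratedLawDichotomyStrainedPatchHomSplit (latPt)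
open Summit.AtomisticToContinuum.Crystallization.Theorems.FrustratedLawDichotomyStrainedPatchHomCentredForm (linear_mem_Icc_of_box)
open Summit.AtomisticToContinuum.Crystallization.Theorems.FrustratedLawDichotomyStrainedPatchHomGram (summand_eq_gram norm_sq_latPt_eq_sum_gram)
open Summit.AtomisticToContinuum.Crystallization.Theorems.FrustratedLawDichotomyStrainedPatchHomTermCalculus (hasDerivAt_phi45 effPot45_eq_far)
open Summit.AtomisticToContinuum.Crystallization.Theorems.FrustratedLawDichotomyStrainedPatchHomLeafPoints

/-! ## §1. Proof-side readings of the data -/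

/-- The label of a record as a function. -/
def NL.toLab (l : NL) : Fin 3 → ℤ := ![l.b0, l.b1, l.b2]

/-- The box centre as a `3 × 3` table. -/
def GB.cz (g : GB) (i j : Fin 3) : ℕ := ![![g.c00, g.c01, g.c02], ![g.c10, g.c11, g.c12], ![g.c20, g.c21, g.c22]] i j

/-- The box half-widths as a `3 × 3` table. -/
def GB.wz (g : GB) (i j : Fin 3) : ℕ := ![![g.w00, g.w01, g.w02], ![g.w10, g.w11, g.w12], ![g.w20, g.w21, g.w22]] i j

/-- The row used for a record (junk if none was found). -/
def rowT (tab : QT) (k : LK) (l : NL) : Row :=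
  match rowOf tab k l with
  | some r => r
  | none => ⟨0, false, 0, false, 0, 0, 0, 0, 0⟩

/-- For a treated record the row used is the row found. [formal bookkeeping] -/
theorem rowOf_eq_rowT {tab : QT} {k : LK} {l : NL} (h : treated tab k l = true) : rowOf tab k l = some (rowT tab k l) := by
  obtain ⟨-, -, row, hr, -⟩ := rowOf_of_treated h
  unfold rowT; rw [hr]

/-! ## §2. The `Fin 9`-indexed sums are the explicit `3 × 3` sums -/

/-- `Σ_{k : Fin 9} F (e⁻¹ k) = Σᵢ Σⱼ F (i, j)` for `e = finProdFinEquiv`. [formal bookkeeping] -/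
theorem sum_fin9 (F : Fin 3 → Fin 3 → ℝ) :
    ∑ k : Fin 9, F ((@finProdFinEquiv 3 3).symm k).1 ((@finProdFinEquiv 3 3).symm k).2 = ∑ i, ∑ j, F i j := by
  rw [← Finset.sum_product', Finset.univ_product_univ]
  exact (Fintype.sum_equiv (@finProdFinEquiv 3 3).symm _ (fun p => F p.1 p.2) fun _ => rfl)

/-- The centre value of a record in real Gram coordinates is `(qPos − qNeg)/SC`. [formal bookkeeping] -/
theorem ell0_eq {l : NL} (hl : l.ok = true) (g : GB) :
    ∑ k : Fin 9, ((l.toLab ((@finProdFinEquiv 3 3).symm k).1 : ℝ) * (l.toLab ((@finProdFinEquiv 3 3).symm k).2 : ℝ)) *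
      (((g.cz ((@finProdFinEquiv 3 3).symm k).1 ((@finProdFinEquiv 3 3).symm k).2 : ℤ) : ℝ) / SC) =
    ((((qPos g.toLK l : ℕ) : ℤ) - ((qNeg g.toLK l : ℕ) : ℤ) : ℤ) : ℝ) / SC := by
  rw [sum_fin9 (fun i j => ((l.toLab i : ℝ) * (l.toLab j : ℝ)) * (((g.cz i j : ℤ) : ℝ) / SC))]
  rw [qPos_sub_qNeg hl]
  simp only [Fin.sum_univ_three, NL.toLab, GB.cz, GB.toLK, Matrix.cons_val_zero, Matrix.cons_val_one, Matrix.cons_val_two,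
    Matrix.head_cons, Matrix.tail_cons, Nat.add_eq]
  push_cast
  ring

/-- The radius of a record in real Gram coordinates is `rad/SC`. [formal bookkeeping] -/
theorem rad_real_eq {l : NL} (hl : l.ok = true) (g : GB) :
    ∑ k : Fin 9, |((l.toLab ((@finProdFinEquiv 3 3).symm k).1 : ℝ) * (l.toLab ((@finProdFinEquiv 3 3).symm k).2 : ℝ))| *
      (((g.wz ((@finProdFinEquiv 3 3).symm k).1 ((@finProdFinEquiv 3 3).symm k).2 : ℤ) : ℝ) / SC) =
    (((rad g.toLK l : ℕ) : ℤ) : ℝ) / SC := by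
  rw [sum_fin9 (fun i j => |((l.toLab i : ℝ) * (l.toLab j : ℝ))| * (((g.wz i j : ℤ) : ℝ) / SC))]
  rw [rad_eq hl]
  simp only [Fin.sum_univ_three, NL.toLab, GB.wz, GB.toLK, Matrix.cons_val_zero, Matrix.cons_val_one, Matrix.cons_val_two,
    Matrix.head_cons, Matrix.tail_cons, Nat.add_eq]
  push_cast
  simp only [abs_mul, abs_mul_abs_self]
  ring

/-- The gradient class of a `Fin 9` coordinate: `L_b (i,j) = bᵢbⱼ` expressed through the record's class data (value in `ℤ`). [formal bookkeeping] -/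
theorem lab_mul_eq {l : NL} (hl : l.ok = true) (i j : Fin 3) :
    (l.toLab i * l.toLab j : ℤ) =
      ![![(l.m00 : ℤ), sgnZ l.s01 l.m01, sgnZ l.s02 l.m02], ![sgnZ l.s01 l.m01, (l.m11 : ℤ), sgnZ l.s12 l.m12],
        ![sgnZ l.s02 l.m02, sgnZ l.s12 l.m12, (l.m22 : ℤ)]] i j := by
  obtain ⟨-, h00, h11, h22, h01, h02, h12⟩ := (NL.ok_iff l).1 hl
  fin_cases i <;> fin_cases j <;>
    simp [NL.toLab, h00, h11, h22, h01, h02, h12, mul_comm]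



/-- Casting a difference of two `ℕ`-valued list sums that agree termwise with an `ℤ`-valued function. [formal bookkeeping] -/
theorem cast_sum_sub_eq (f g : NL → ℕ) (h : NL → ℤ) : ∀ (T : List NL), (∀ l ∈ T, ((f l : ℕ) : ℤ) - g l = h l) →
    (((T.map f).sum : ℕ) : ℤ) - (((T.map g).sum : ℕ) : ℤ) = (T.map h).sum
  | [], _ => by simp
  | l :: T, hT => by
    rw [List.map_cons, List.map_cons, List.map_cons, List.sum_cons, List.sum_cons, List.sum_cons, Nat.cast_add, Nat.cast_add,
      ← hT l List.mem_cons_self, ← cast_sum_sub_eq f g h T (fun l' hl' => hT l' (List.mem_cons_of_mem _ hl'))]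
    ring

/-! ## §3. What a passing leaf check says in `ℤ` -/

/-- Unpacking `final`. [formal bookkeeping] -/
theorem final_true {E A0 A1 A2 A3 A4 A5 : ℕ} {k : LK} {sμ : Bool} {aμ : ℕ} {a : Acc} (h : final E A0 A1 A2 A3 A4 A5 k sμ aμ a = true) :
    a.ok = true ∧ lhs E (addP sμ aμ 0) (gradPen E A0 A1 A2 A3 A4 A5 k a) a ≤ rhs (addN sμ aμ 0) a := by
  unfold final at h
  simp only [Bool.and_eq_true, Nat.ble_eq] at h
  exact h

/-- The scaled centre offset `δ = q0 − t` of a record (junk if untreated). -/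
def dlt (tab : QT) (k : LK) (l : NL) : ℕ := q0N k l - (rowT tab k l).t

/-- ★ **THE ACCUMULATOR SUMS.**  For a passing fold, with `T` = the treated visited records: every visited record passes its step, and the signed
accumulator fields are the sums over `T` of the per-record data read from the rows used. [formal bookkeeping] -/
theorem acc_sums {tab : QT} {k : LK} {nstop : ℕ} {labs : List NL} (hok : (foldNL tab k nstop acc0 labs).ok = true) :
    (∀ l ∈ visited nstop labs, stepOK tab k l = true) ∧
    (((foldNL tab k nstop acc0 labs).vP : ℤ) - (foldNL tab k nstop acc0 labs).vN =
      (((visited nstop labs).filter (fun l => treated tab k l)).map (fun l => sgnZ (rowT tab k l).sV (rowT tab k l).aV)).sum) ∧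
    (((foldNL tab k nstop acc0 labs).dP : ℤ) - (foldNL tab k nstop acc0 labs).dN =
      (((visited nstop labs).filter (fun l => treated tab k l)).map
        (fun l => sgnZ (rowT tab k l).sD (rowT tab k l).aD * (dlt tab k l : ℤ))).sum) ∧
    ((foldNL tab k nstop acc0 labs).sd = (((visited nstop labs).filter (fun l => treated tab k l)).map (fun l => dlt tab k l)).sum) ∧
    (((foldNL tab k nstop acc0 labs).g0P : ℤ) - (foldNL tab k nstop acc0 labs).g0N =
      (((visited nstop labs).filter (fun l => treated tab k l)).map (fun l => sgnZ (rowT tab k l).sD (rowT tab k l).aD * (l.m00 : ℤ))).sum) ∧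
    (((foldNL tab k nstop acc0 labs).g1P : ℤ) - (foldNL tab k nstop acc0 labs).g1N =
      (((visited nstop labs).filter (fun l => treated tab k l)).map (fun l => sgnZ (rowT tab k l).sD (rowT tab k l).aD * (l.m11 : ℤ))).sum) ∧
    (((foldNL tab k nstop acc0 labs).g2P : ℤ) - (foldNL tab k nstop acc0 labs).g2N =
      (((visited nstop labs).filter (fun l => treated tab k l)).map (fun l => sgnZ (rowT tab k l).sD (rowT tab k l).aD * (l.m22 : ℤ))).sum) ∧
    (((foldNL tab k nstop acc0 labs).g3P : ℤ) - (foldNL tab k nstop acc0 labs).g3N =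
      (((visited nstop labs).filter (fun l => treated tab k l)).map
        (fun l => sgnZ (rowT tab k l).sD (rowT tab k l).aD * sgnZ l.s01 l.m01)).sum) ∧
    (((foldNL tab k nstop acc0 labs).g4P : ℤ) - (foldNL tab k nstop acc0 labs).g4N =
      (((visited nstop labs).filter (fun l => treated tab k l)).map
        (fun l => sgnZ (rowT tab k l).sD (rowT tab k l).aD * sgnZ l.s02 l.m02)).sum) ∧
    (((foldNL tab k nstop acc0 labs).g5P : ℤ) - (foldNL tab k nstop acc0 labs).g5N =
      (((visited nstop labs).filter (fun l => treated tab k l)).map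
        (fun l => sgnZ (rowT tab k l).sD (rowT tab k l).aD * sgnZ l.s12 l.m12)).sum) ∧
    ((foldNL tab k nstop acc0 labs).cur = (((visited nstop labs).filter (fun l => treated tab k l)).map
        (fun l => (rowT tab k l).M * ((dlt tab k l + rad k l) * (dlt tab k l + rad k l)))).sum) := by
  rw [foldNL_eq] at hok ⊢
  obtain ⟨-, hall, heq⟩ := foldl_step_eq tab k (visited nstop labs) acc0 hok
  rw [heq]
  set T := (visited nstop labs).filter (fun l => treated tab k l) with hT
  have hTt : ∀ l ∈ T, treated tab k l = true := fun l hl => (List.mem_filter.1 hl).2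
  -- per-record field identities on T
  have hF : ∀ l ∈ T, (incr tab k l).ok = true ∧
      (((incr tab k l).vP : ℕ) : ℤ) - (incr tab k l).vN = sgnZ (rowT tab k l).sV (rowT tab k l).aV ∧
      (((incr tab k l).dP : ℕ) : ℤ) - (incr tab k l).dN = sgnZ (rowT tab k l).sD (rowT tab k l).aD * ((dlt tab k l : ℕ) : ℤ) ∧
      (incr tab k l).sd = dlt tab k l ∧
      (((incr tab k l).g0P : ℕ) : ℤ) - (incr tab k l).g0N = sgnZ (rowT tab k l).sD (rowT tab k l).aD * (l.m00 : ℤ) ∧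
      (((incr tab k l).g1P : ℕ) : ℤ) - (incr tab k l).g1N = sgnZ (rowT tab k l).sD (rowT tab k l).aD * (l.m11 : ℤ) ∧
      (((incr tab k l).g2P : ℕ) : ℤ) - (incr tab k l).g2N = sgnZ (rowT tab k l).sD (rowT tab k l).aD * (l.m22 : ℤ) ∧
      (((incr tab k l).g3P : ℕ) : ℤ) - (incr tab k l).g3N = sgnZ (rowT tab k l).sD (rowT tab k l).aD * sgnZ l.s01 l.m01 ∧
      (((incr tab k l).g4P : ℕ) : ℤ) - (incr tab k l).g4N = sgnZ (rowT tab k l).sD (rowT tab k l).aD * sgnZ l.s02 l.m02 ∧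
      (((incr tab k l).g5P : ℕ) : ℤ) - (incr tab k l).g5N = sgnZ (rowT tab k l).sD (rowT tab k l).aD * sgnZ l.s12 l.m12 ∧
      (incr tab k l).cur = (rowT tab k l).M * ((dlt tab k l + rad k l) * (dlt tab k l + rad k l)) :=
    fun l hl => incr_fields (hTt l hl) (rowOf_eq_rowT (hTt l hl))
  have e0 : ∀ (P N : Acc → ℕ), (∀ a c, P (a.add c) = P a + P c) → (∀ a c, N (a.add c) = N a + N c) → P acc0 = 0 → N acc0 = 0 →
      ∀ (hfn : NL → ℤ), (∀ l ∈ T, ((P (incr tab k l) : ℕ) : ℤ) - ((N (incr tab k l) : ℕ) : ℤ) = hfn l) →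
      ((P (T.foldl (fun acc l => acc.add (incr tab k l)) acc0) : ℕ) : ℤ) - ((N (T.foldl (fun acc l => acc.add (incr tab k l)) acc0) : ℕ) : ℤ) =
        ((T.map hfn).sum : ℤ) := by
    intro P N hP hN hP0 hN0 hfn hh
    rw [proj_sub_foldl_add P N hP hN (incr tab k) T acc0, hP0, hN0]
    have := cast_sum_sub_eq (fun l => P (incr tab k l)) (fun l => N (incr tab k l)) hfn T hh
    simp only [Nat.cast_zero, sub_zero, zero_add]
    rw [← this]
  have e1 : ∀ (P : Acc → ℕ), (∀ a c, P (a.add c) = P a + P c) → P acc0 = 0 → ∀ (hfn : NL → ℕ), (∀ l ∈ T, P (incr tab k l) = hfn l) →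
      P (T.foldl (fun acc l => acc.add (incr tab k l)) acc0) = ((T.map hfn).sum : ℕ) := by
    intro P hP hP0 hfn hh
    rw [proj_foldl_add P hP (incr tab k) T acc0, hP0, Nat.zero_add]
    exact congrArg List.sum (List.map_congr_left hh)
  refine ⟨hall, ?_, ?_, ?_, ?_, ?_, ?_, ?_, ?_, ?_, ?_⟩
  · exact e0 Acc.vP Acc.vN (fun _ _ => rfl) (fun _ _ => rfl) rfl rfl _ (fun l hl => (hF l hl).2.1)
  · exact e0 Acc.dP Acc.dN (fun _ _ => rfl) (fun _ _ => rfl) rfl rfl _ (fun l hl => (hF l hl).2.2.1)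
  · exact e1 Acc.sd (fun _ _ => rfl) rfl _ (fun l hl => (hF l hl).2.2.2.1)
  · exact e0 Acc.g0P Acc.g0N (fun _ _ => rfl) (fun _ _ => rfl) rfl rfl _ (fun l hl => (hF l hl).2.2.2.2.1)
  · exact e0 Acc.g1P Acc.g1N (fun _ _ => rfl) (fun _ _ => rfl) rfl rfl _ (fun l hl => (hF l hl).2.2.2.2.2.1)
  · exact e0 Acc.g2P Acc.g2N (fun _ _ => rfl) (fun _ _ => rfl) rfl rfl _ (fun l hl => (hF l hl).2.2.2.2.2.2.1)
  · exact e0 Acc.g3P Acc.g3N (fun _ _ => rfl) (fun _ _ => rfl) rfl rfl _ (fun l hl => (hF l hl).2.2.2.2.2.2.2.1)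
  · exact e0 Acc.g4P Acc.g4N (fun _ _ => rfl) (fun _ _ => rfl) rfl rfl _ (fun l hl => (hF l hl).2.2.2.2.2.2.2.2.1)
  · exact e0 Acc.g5P Acc.g5N (fun _ _ => rfl) (fun _ _ => rfl) rfl rfl _ (fun l hl => (hF l hl).2.2.2.2.2.2.2.2.2.1)
  · exact e1 Acc.cur (fun _ _ => rfl) rfl _ (fun l hl => (hF l hl).2.2.2.2.2.2.2.2.2.2)


end Summit.AtomisticToContinuum.Crystallization.Theorems.FrustratedLawDichotomyStrainedPatchHomLeafTableCheck

end
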